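import Literature.NumberTheory.Automorphic.JacquetShalikaLargeFinsetProofs
import HarnessLib

/-!
# Jacquet–Shalika's Lemma (5.2): proof file — the lemma from the junction (J)

Topic `NumberTheory/Automorphic`; namespace `Literature.NumberTheory.Automorphic`. Sibling proof
file (theorems only: no definition, no named fact) of `JacquetShalikaEulerProducts`, destined to
hold the discharge `JacquetShalika1981_continuation_partialPairL_conj_holds` of the named fact
`JacquetShalika1981_continuation_partialPairL_conj` (Jacquet–Shalika, *On Euler products and the
classification of automorphic representations I*, Amer. J. Math. **103** (1981), Lemma (5.2),
p. 554: `L_S(s, π × π̄)` continues holomorphically to `re s > 1`).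

This first instalment records that, in the tree, Lemma (5.2) is **equivalent** to the junction
**(J)** = `summable_normSq_trace_largeFinset` of `JacquetShalikaLargeFinset` ((5.3.3)–(5.3.4) off
large finite sets) and hence to the boundedness of the unramified Rankin–Selberg torus-sum products
`JacquetShalika1981_schurSelfSum_prod_bounded` (`JacquetShalikaSchurSelfSum`):

* `JacquetShalika1981_continuation_partialPairL_conj_of_largeFinset` — **(J) ⇒ Lemma (5.2)**, with
  the *same* exceptional set `S₀`: for `S ⊇ S₀` and a Satake family `α` off `S`, the series (5.3.3)
  converges for every `σ > 1`, so `exp (∑_N a_N N^{-s})` is holomorphic on `re s > 1`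
  (`differentiableOn_cexp_LSeries_normSqTraceSeries` of `JacquetShalikaLargeFinsetProofs`) and agrees
  with the Euler product `L_S(s, α × ᾱ) = partialPairL S α (conjFamily α) s` on `re s > 2(n² + 1) + 1`
  (`cexp_LSeries_normSqTraceSeries_eq_partialPairL_of_rpow` with the proved trivial bound
  `IsSatakeFamilyOf.norm_le_rpow`); compare `continuation_partialPairL_conj_of_summable` of
  `PairLFunctionBaseChangeProofs`, the same argument from the arbitrary-`S` fact;
* `JacquetShalika1981_continuation_partialPairL_conj_iff_largeFinset` — with
  `summable_normSq_trace_largeFinset_of_lemma52` (Landau's lemma, `JacquetShalikaLargeFinset`);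
* `JacquetShalika1981_continuation_partialPairL_conj_of_schurSelfSum_prod_bounded`,
  `…_iff_schurSelfSum_prod_bounded` — through `JacquetShalikaSchurSelfSum`.

The remaining input is therefore exactly a proof of (J), the common target of the real-point
Rankin–Selberg programme of the topic (`RankinSelbergTorusIntegral`, `MirabolicFourierStage`,
`WhittakerCoeffCuspidal`, …); `JacquetShalika1981_continuation_partialPairL_conj_holds` will be added
to this file when it lands.

## References

* H. Jacquet, J. A. Shalika, *On Euler products and the classification of automorphic
  representations I*, Amer. J. Math. 103 (1981), 499–558: Lemma (5.2) p. 554, proof p. 555; proof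
  of Thm. (5.3), (5.3.3)–(5.3.4) and (2)–(4), p. 556 [JacquetShalikaAJM1981].
-/

noncomputable section

open NumberField IsDedekindDomain MeasureTheory Complex

namespace Literature.NumberTheory.Automorphic

variable {n : ℕ} {K : Type} [Field K] [NumberField K]
  {μ : Measure (AdelicGroupData.gl n K).automorphicQuotient}
  [(AdelicGroupData.gl n K).IsAutomorphicMeasure μ]

/-- **(J) implies Lemma (5.2)**: if for every cuspidal `Π` the series (5.3.3) converges for all
`σ > 1` off every finite `S ⊇ S₀` (`summable_normSq_trace_largeFinset`), then
`JacquetShalika1981_continuation_partialPairL_conj` holds, with the same `S₀`, the continuation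
`exp (∑_N a_N N^{-s})` and the abscissa `x₀ = 2(n² + 1) + 1` (Jacquet–Shalika (1981), p. 556,
(2)–(4), read at the line `σ = 1`). [cite: JacquetShalikaAJM1981, Lemma (5.2), Thm. (5.3) proof, (5.3.3)–(5.3.4)] -/
theorem JacquetShalika1981_continuation_partialPairL_conj_of_largeFinset
    (h : summable_normSq_trace_largeFinset (μ := μ)) :
    JacquetShalika1981_continuation_partialPairL_conj (μ := μ) := by
  intro P
  obtain ⟨S₀, hS₀⟩ := h P
  refine ⟨S₀, fun S α hS hα => ⟨fun s => cexp (LSeries (normSqTraceSeries (↑S) α) s),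
    2 * ((n : ℝ) ^ 2 + 1) + 1, differentiableOn_cexp_LSeries_normSqTraceSeries (hS₀ hS hα),
    fun s hs => ?_⟩⟩
  exact cexp_LSeries_normSqTraceSeries_eq_partialPairL_of_rpow (n := n) (B := (n : ℝ) ^ 2 + 1)
    (fun v hv a ha => hα.norm_le_rpow hv ha) (fun v hv => (hα.card_eq hv).le) hs

/-- **Lemma (5.2) is equivalent to (J)** in the tree (the converse is Landau's lemma with the
proved trivial bound, `summable_normSq_trace_largeFinset_of_lemma52`). [folklore] -/
theorem JacquetShalika1981_continuation_partialPairL_conj_iff_largeFinset :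
    JacquetShalika1981_continuation_partialPairL_conj (μ := μ) ↔
      summable_normSq_trace_largeFinset (μ := μ) :=
  ⟨summable_normSq_trace_largeFinset_of_lemma52,
    JacquetShalika1981_continuation_partialPairL_conj_of_largeFinset⟩

/-- **Lemma (5.2) from the boundedness of the unramified Rankin–Selberg torus-sum products**
(`JacquetShalika1981_schurSelfSum_prod_bounded` of `JacquetShalikaSchurSelfSum`, through (J)).
[cite: JacquetShalikaAJM1981, Lemma (5.2), §4 and §2] -/
theorem JacquetShalika1981_continuation_partialPairL_conj_of_schurSelfSum_prod_bounded
    (h : JacquetShalika1981_schurSelfSum_prod_bounded (μ := μ)) :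
    JacquetShalika1981_continuation_partialPairL_conj (μ := μ) :=
  JacquetShalika1981_continuation_partialPairL_conj_of_largeFinset
    (summable_normSq_trace_largeFinset_of_schurSelfSum_prod_bounded h)

/-- **Lemma (5.2) is equivalent to the boundedness of the torus-sum products.** [folklore] -/
theorem JacquetShalika1981_continuation_partialPairL_conj_iff_schurSelfSum_prod_bounded :
    JacquetShalika1981_continuation_partialPairL_conj (μ := μ) ↔
      JacquetShalika1981_schurSelfSum_prod_bounded (μ := μ) :=
  ⟨fun h => JacquetShalika1981_schurSelfSum_prod_bounded_of_largeFinset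
      (summable_normSq_trace_largeFinset_of_lemma52 h),
    JacquetShalika1981_continuation_partialPairL_conj_of_schurSelfSum_prod_bounded⟩

end Literature.NumberTheory.Automorphic
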